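import Literature.Geometry.Lorentzian.CoordShrinkerRmDrift
import Literature.Geometry.Lorentzian.CoordTensorNorm
import HarnessLib

/-!
# Munteanu–Wang 2015, Thm. 1.4 (second half) at a point: the drift Laplacian of
# `w = √(|∇Rm|² + 1) + |Rm|²` on a four-dimensional gradient shrinker, in coordinates

Pointwise coordinate computation (metric components `G : E → (E →L E →L ℝ)` on an open `V`,
`MetricCoord.IsMetricOn G V`, positive definite at the point `x`) behind the second half of the
proof of **Munteanu–Wang 2015, Thm. 1.4** ("Let us now prove that `∇Rm` is bounded as well", p. 6
of the arXiv text: from `Δ_f Rm = Rm + Rm ∗ Rm` one has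
`Δ_f |∇Rm|² ≥ 2|∇∇Rm|² − c|∇Rm|²`, hence `Δ_f |∇Rm| ≥ −c|∇Rm|` once `|Rm|` is bounded, and
"`Δ_f(|∇Rm| + |Rm|²) ≥ (|∇Rm| + |Rm|²)² − c`"), in the variant with the smooth function
`√(|∇Rm|² + 1)` in place of `|∇Rm|` (so that no regularisation at the zeros of `∇Rm` is needed)
and with all constants explicit. Here `|∇Rm|² = tnormSq G b (tcov G b (rm4 G b))` and
`|∇∇Rm|² = tnormSq G b (tcov G b (tcov G b (rm4 G b)))` are the component norms of the rank-generic
tensor calculus (`CoordTensorCalculus.lean`, `CoordTensorNorm.lean`) in a basis `b`, and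
`|Rm|² = rmNormSqAt G`:

* `mw_sqrt_cov_drift_ge`, `mw_cov_rm_drift_arith` — the real arithmetic of the proof (p. 6): with
  `ρ = √(|∇Rm|² + 1)`, `Δ_f ρ ≥ −½ C₁(√K₀ + 1) ρ` from
  `Δ_f |∇Rm|² ≥ 2|∇∇Rm|² + 3|∇Rm|² − C₁(|Rm| + 1)|∇Rm|²`, Kato `|∇|∇Rm|²|² ≤ 4|∇Rm|²|∇∇Rm|²` and
  `|Rm|² ≤ K₀`; then `Δ_f(ρ + |Rm|²) ≥ ½(ρ + |Rm|²)² − K` from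
  `Δ_f |Rm|² ≥ 2|∇Rm|² − C₅(|Rm| + 1)|Rm|²`, with the explicit constant
  `K = 2 + 2K₀² + C₅(√K₀ + 1)K₀ + C₁²(√K₀ + 1)²`;
* `IsMetricOn.mw_drift_sqrt_covRmNormSq_add_rmNormSqAt` — **the pointwise drift inequality**:
  GIVEN at `x` (i) the `|Rm|²` drift inequality `Δ|Rm|² − d|Rm|²(W) ≥ 2|∇Rm|² − C₅(|Rm| + 1)|Rm|²`
  (the soliton identity `Δ_f Rm = Rm + Rm ∗ Rm`, file `CoordShrinkerRmNormSqDrift`), (ii) the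
  `|∇Rm|²` drift inequality `Δ|∇Rm|² − d|∇Rm|²(W) ≥ 2|∇∇Rm|² + 3|∇Rm|² − C₁(|Rm| + 1)|∇Rm|²` with
  the Kato inequality `|∇|∇Rm|²|² ≤ 4|∇Rm|² |∇∇Rm|²` (the commutation formula
  `Δ_f ∇Rm = ½∇Rm + Rm ∗ ∇Rm`), and the curvature bound `|Rm|² ≤ K₀` (first half of Thm. 1.4):
  for `w = √(|∇Rm|² + 1) + |Rm|²` and every vector `W`,
  `Δ_G w − dw(W) ≥ ½ w² − (2 + 2K₀² + C₅(√K₀ + 1)K₀ + C₁²(√K₀ + 1)²)`; for `W = ♯df` this is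
  `Δ_f w ≥ ½ w² − c`. The two drift inequalities are taken as hypotheses here (they are proved in
  the sibling files), so that this file only depends on the coordinate calculus already in the
  tree (local chain rule for `√(t+1)` and linearity of the drift Laplacian,
  `lapAt_sub_fderiv_comp_add` of `CoordShrinkerRmDrift.lean`); in particular neither the soliton
  equation nor any property of `f` is used beyond the displayed inputs.

First user: the boundedness of `|∇Rm|` on complete four-dimensional gradient shrinkers with bounded
scalar curvature (Munteanu–Wang 2015, Thm. 1.4, second half), step 1 of the printed chain behind
the named fact `shrinkerSplittingAtInfinity_four` (crux `EntropyRung.NoncompactShrinkerGap`,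
SmoothPoincare4). Everything is proved; no definition and no statement of `Prop` type is introduced.

## References

* O. Munteanu, J. Wang, *Geometry of shrinking Ricci solitons*, Compositio Math. 151 (2015)
  2273–2300 = arXiv:1410.3813, §1: Thm. 1.4 and its proof (p. 6): "`Δ_f |∇Rm| ≥ −c|∇Rm|`",
  "`Δ_f(|∇Rm| + |Rm|²) ≥ (|∇Rm| + |Rm|²)² − c`", "the maximum principle then shows that `|∇Rm|`
  is bounded on `M`". READ (arXiv text). [MunteanuWang2015]
* B. O'Neill, *Semi-Riemannian geometry with applications to relativity*, Academic Press 1983, Ch. 3,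
  pp. 60–61, Def. 3.50 (the chain rule for the Laplacian). [ONeill1983]
-/

noncomputable section

set_option maxSynthPendingDepth 3

open Set Filter ContinuousLinearMap Module
open scoped Topology ContDiff

namespace Literature.Geometry.Lorentzian

namespace MetricCoord

variable {E : Type*} [NormedAddCommGroup E] [NormedSpace ℝ E] [FiniteDimensional ℝ E]
  {G : E → E →L[ℝ] E →L[ℝ] ℝ} {V : Set E} {x : E}

/-! ### Real-variable lemmas (the arithmetic of the second half of the proof of Thm. 1.4) -/

section Real

/-- **`Δ_f ρ ≥ −½ C (k + 1) ρ` for `ρ = √(|∇Rm|² + 1)`**: with `M = |∇Rm|² ≥ 0`, `ρ² = M + 1`,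
`N = |∇∇Rm|² ≥ 0`, `m = |Rm| ≤ k`, from `Δ_f M ≥ 2N + 3M − C(m + 1)M`, `|∇M|² ≤ 4MN` and the chain
rule `Δ_f ρ = ½(M+1)^{-1/2} Δ_f M − ¼(M+1)^{-3/2}|∇M|²` (written with `(M+1)^{-1/2} = ρ/(M+1)`,
`(M+1)^{-3/2} = ρ/(M+1)²`):
`Δ_f ρ ≥ (N(ρ² − M) + (3/2)Mρ² − ½C(m+1)Mρ²)/ρ³ ≥ −½C(k+1)ρ` (`ρ² − M = 1`, `M ≤ ρ²`).
[cite: MunteanuWang2015, Thm. 1.4 (proof)] -/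
theorem mw_sqrt_cov_drift_ge {M ρ m k C N LM gM : ℝ} (hM0 : 0 ≤ M) (hρ0 : 0 < ρ)
    (hρ2 : ρ ^ 2 = M + 1) (hmk : m ≤ k) (hk : 0 ≤ k) (hC : 0 ≤ C) (hN0 : 0 ≤ N)
    (hN1 : 2 * N + 3 * M - C * (m + 1) * M ≤ LM) (hN2 : gM ≤ 4 * M * N) :
    -(C * (k + 1) / 2 * ρ) ≤ 1 / 2 * (ρ / (M + 1)) * LM + -(1 / 4) * (ρ / (M + 1) ^ 2) * gM := by
  have e1 : ρ / (M + 1) = 1 / ρ := by rw [← hρ2, sq, ← div_div, div_self hρ0.ne']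
  have e2 : ρ / (M + 1) ^ 2 = 1 / ρ ^ 3 := by
    rw [← hρ2, div_eq_div_iff (by positivity) (by positivity)]
    ring
  rw [e1, e2]
  have h1 : 1 / 2 * (1 / ρ) * (2 * N + 3 * M - C * (m + 1) * M) ≤ 1 / 2 * (1 / ρ) * LM :=
    mul_le_mul_of_nonneg_left hN1 (by positivity)
  have h2 : 1 / 4 * (1 / ρ ^ 3) * gM ≤ 1 / 4 * (1 / ρ ^ 3) * (4 * M * N) :=
    mul_le_mul_of_nonneg_left hN2 (by positivity)
  -- `C (m+1) M ≤ C (k+1) ρ²`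
  have hCM : C * (m + 1) * M ≤ C * (k + 1) * ρ ^ 2 := by
    have hMρ : M ≤ ρ ^ 2 := by rw [hρ2]; linarith
    calc C * (m + 1) * M ≤ C * (k + 1) * M :=
          mul_le_mul_of_nonneg_right (mul_le_mul_of_nonneg_left (by linarith) hC) hM0
      _ ≤ C * (k + 1) * ρ ^ 2 := mul_le_mul_of_nonneg_left hMρ (by positivity)
  have hkey : -(C * (k + 1) / 2 * ρ) ≤
      1 / 2 * (1 / ρ) * (2 * N + 3 * M - C * (m + 1) * M) - 1 / 4 * (1 / ρ ^ 3) * (4 * M * N) := by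
    have hid : 1 / 2 * (1 / ρ) * (2 * N + 3 * M - C * (m + 1) * M)
          - 1 / 4 * (1 / ρ ^ 3) * (4 * M * N) =
        (N * (ρ ^ 2 - M) + 3 / 2 * M * ρ ^ 2 - 1 / 2 * (C * (m + 1) * M) * ρ ^ 2) / ρ ^ 3 := by
      field_simp
      ring
    have hid2 : -(C * (k + 1) / 2 * ρ) = -(1 / 2 * (C * (k + 1) * ρ ^ 2) * ρ ^ 2) / ρ ^ 3 := by
      field_simp
    rw [hid, hid2, div_le_div_iff_of_pos_right (by positivity)]
    have h4 : ρ ^ 2 - M = 1 := by linarith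
    rw [h4, mul_one]
    have h3 : 1 / 2 * (C * (m + 1) * M) * ρ ^ 2 ≤ 1 / 2 * (C * (k + 1) * ρ ^ 2) * ρ ^ 2 :=
      mul_le_mul_of_nonneg_right (mul_le_mul_of_nonneg_left hCM (by norm_num)) (by positivity)
    linarith [h3, hN0, mul_nonneg hM0 (sq_nonneg ρ)]
  linarith [hkey, h1, h2]

/-- **The arithmetic of the second half of the proof of Thm. 1.4** for `w = ρ + U₀`
(`ρ = √(|∇Rm|² + 1)`, `M = |∇Rm|²`, `U₀ = |Rm|² ≤ K₀`, `m = |Rm| ≤ k = √K₀`): from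
`Δ_f ρ ≥ −½C₁(k+1)ρ` and `Δ_f U₀ ≥ 2M − C₅(m+1)U₀` one gets
`Δ_f w ≥ 2ρ² − 2 − C₅(k+1)K₀ − ½C₁(k+1)ρ ≥ (3/2)ρ² − 2 − C₅(k+1)K₀ − C₁²(k+1)²/8` and
`½w² ≤ ρ² + K₀²`, whence `Δ_f w ≥ ½w² − (2 + 2K₀² + C₅(k+1)K₀ + C₁²(k+1)²)`.
[cite: MunteanuWang2015, Thm. 1.4 (proof)] -/
theorem mw_cov_rm_drift_arith {M ρ U₀ m k K₀ C₁ C₅ L₀ A drift : ℝ} (hρ2 : ρ ^ 2 = M + 1)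
    (hU0 : 0 ≤ U₀) (hUK : U₀ ≤ K₀) (hm0 : 0 ≤ m) (hmk : m ≤ k) (hC₅ : 0 ≤ C₅)
    (hL : 2 * M - C₅ * (m + 1) * U₀ ≤ L₀) (hA : -(C₁ * (k + 1) / 2 * ρ) ≤ A)
    (hdrift : drift = A + L₀) :
    1 / 2 * (ρ + U₀) ^ 2 - (2 + 2 * K₀ ^ 2 + C₅ * (k + 1) * K₀ + C₁ ^ 2 * (k + 1) ^ 2) ≤ drift := by
  -- `C₅(m+1)U₀ ≤ C₅(k+1)K₀`
  have h1 : C₅ * (m + 1) * U₀ ≤ C₅ * (k + 1) * K₀ := by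
    calc C₅ * (m + 1) * U₀ = C₅ * ((m + 1) * U₀) := by ring
      _ ≤ C₅ * ((k + 1) * K₀) :=
          mul_le_mul_of_nonneg_left (mul_le_mul (by linarith) hUK hU0 (by linarith)) hC₅
      _ = C₅ * (k + 1) * K₀ := by ring
  -- `½C₁(k+1)ρ ≤ ½ρ² + C₁²(k+1)²/8`
  have h2 : C₁ * (k + 1) / 2 * ρ ≤ 1 / 2 * ρ ^ 2 + 1 / 2 * (C₁ * (k + 1) / 2) ^ 2 := by
    nlinarith [sq_nonneg (ρ - C₁ * (k + 1) / 2)]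
  -- `w² ≤ 2ρ² + 2K₀²`
  have h3 : (ρ + U₀) ^ 2 ≤ 2 * ρ ^ 2 + 2 * K₀ ^ 2 := by
    have hUsq : U₀ ^ 2 ≤ K₀ ^ 2 := pow_le_pow_left₀ hU0 hUK 2
    nlinarith [sq_nonneg (ρ - U₀), hUsq]
  rw [hdrift]
  nlinarith [h1, h2, h3, hL, hA, hρ2, sq_nonneg K₀, sq_nonneg (C₁ * (k + 1)), sq_nonneg ρ]

end Real

/-! ### Munteanu–Wang's Thm. 1.4 at a point, for `w = √(|∇Rm|² + 1) + |Rm|²` -/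

variable [CompleteSpace E]

/-- **The drift inequality for `w = √(|∇Rm|² + 1) + |Rm|²` on a four-dimensional gradient shrinker
with bounded curvature, in coordinates** (Munteanu–Wang 2015, second half of the proof of
Thm. 1.4, with `|∇Rm|` replaced by the smooth `√(|∇Rm|² + 1)` and all constants explicit): at a
positive definite point `x ∈ V` of metric components `G`, in a basis `b`, for a vector `W`
(`W = ♯df` gives the drift Laplacian `Δ_f = Δ_G − ⟨∇f, ∇·⟩`), GIVEN at `x` the two pointwise inputs
(i) `Δ|Rm|² − d|Rm|²(W) ≥ 2|∇Rm|² − C₅(|Rm| + 1)|Rm|²` and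
(ii) `Δ|∇Rm|² − d|∇Rm|²(W) ≥ 2|∇∇Rm|² + 3|∇Rm|² − C₁(|Rm| + 1)|∇Rm|²` together with the Kato
inequality `|∇|∇Rm|²|² ≤ 4 |∇Rm|² |∇∇Rm|²` — with `|∇Rm|² = tnormSq G b (tcov G b (rm4 G b))`,
`|∇∇Rm|² = tnormSq G b (tcov G b (tcov G b (rm4 G b)))` — and the bounds `0 ≤ C₁`, `0 ≤ C₅`,
`|Rm|² ≤ K₀`, one has
`Δ_G w − dw(W) ≥ ½ w² − (2 + 2K₀² + C₅(√K₀ + 1)K₀ + C₁²(√K₀ + 1)²)`.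
[cite: MunteanuWang2015, Thm. 1.4 (proof)] -/
theorem IsMetricOn.mw_drift_sqrt_covRmNormSq_add_rmNormSqAt (hG : IsMetricOn G V) (hx : x ∈ V)
    (hpos : ∀ v : E, v ≠ 0 → 0 < G x v v) (W : E) {ι : Type*} [Fintype ι] (b : Basis ι ℝ E)
    {C₁ C₅ K₀ : ℝ} (hC₁ : 0 ≤ C₁) (hC₅ : 0 ≤ C₅) (hMK : rmNormSqAt G x ≤ K₀)
    (hRm : 2 * tnormSq G b (tcov G b (rm4 G b)) x
        - C₅ * (Real.sqrt (rmNormSqAt G x) + 1) * rmNormSqAt G x ≤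
      lapAt G (rmNormSqAt G) x - fderiv ℝ (rmNormSqAt G) x W)
    (hCov : 2 * tnormSq G b (tcov G b (tcov G b (rm4 G b))) x
          + 3 * tnormSq G b (tcov G b (rm4 G b)) x
          - C₁ * (Real.sqrt (rmNormSqAt G x) + 1) * tnormSq G b (tcov G b (rm4 G b)) x ≤
        lapAt G (tnormSq G b (tcov G b (rm4 G b))) x
          - fderiv ℝ (tnormSq G b (tcov G b (rm4 G b))) x W)
    (hKato : gradSqAt G (tnormSq G b (tcov G b (rm4 G b))) x ≤
        4 * tnormSq G b (tcov G b (rm4 G b)) x * tnormSq G b (tcov G b (tcov G b (rm4 G b))) x) :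
    1 / 2 * ((tnormSq G b (tcov G b (rm4 G b)) x + 1) ^ (1 / 2 : ℝ) + rmNormSqAt G x) ^ 2
        - (2 + 2 * K₀ ^ 2 + C₅ * (Real.sqrt K₀ + 1) * K₀ + C₁ ^ 2 * (Real.sqrt K₀ + 1) ^ 2) ≤
      lapAt G (fun y ↦ (tnormSq G b (tcov G b (rm4 G b)) y + 1) ^ (1 / 2 : ℝ) + rmNormSqAt G y) x
        - fderiv ℝ (fun y ↦ (tnormSq G b (tcov G b (rm4 G b)) y + 1) ^ (1 / 2 : ℝ) + rmNormSqAt G y)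
            x W := by
  -- ### names and signs
  set P : E → ℝ := tnormSq G b (tcov G b (rm4 G b)) with hPdef
  have hs := hG.symm x hx
  have hP0 : 0 ≤ P x := tnormSq_nonneg b hs hpos _
  have hQ0 : 0 ≤ tnormSq G b (tcov G b (tcov G b (rm4 G b))) x := tnormSq_nonneg b hs hpos _
  obtain ⟨e, he⟩ := exists_orthonormal_basis hs hpos
  have hM0 : 0 ≤ rmNormSqAt G x := hG.rmNormSqAt_nonneg e he hx
  have hσpos : 0 < P x + 1 := by linarith
  -- ### the value `ρ = (|∇Rm|² + 1)^{1/2}`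
  set ρ : ℝ := (P x + 1) ^ (1 / 2 : ℝ) with hρdef
  have hρ0 : 0 < ρ := Real.rpow_pos_of_pos hσpos _
  have hρ2 : ρ ^ 2 = P x + 1 := by
    rw [hρdef, ← Real.sqrt_eq_rpow, Real.sq_sqrt hσpos.le]
  -- ### regularity and the expansion
  have hP2 : ContDiffAt ℝ 2 P x :=
    (((hG.contDiffOn_tnormSq (hG.tsmoothOn_tcov (hG.tsmoothOn_rm4 b))) x hx).contDiffAt
      (hG.mem_nhds hx)).of_le (by norm_cast)
  have hM2 : ContDiffAt ℝ 2 (rmNormSqAt G) x :=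
    ((hG.contDiffOn_rmNormSqAt x hx).contDiffAt (hG.mem_nhds hx)).of_le (by norm_cast)
  have hφ : ContDiffAt ℝ 2 (fun s : ℝ ↦ (s + 1) ^ (1 / 2 : ℝ)) (P x) := contDiffAt_profile _ hσpos
  have hexp := lapAt_sub_fderiv_comp_add (G := G) hM2 hP2 hφ W
  have hd1 : deriv (fun s : ℝ ↦ (s + 1) ^ (1 / 2 : ℝ)) (P x) = 1 / 2 * (ρ / (P x + 1)) := by
    rw [deriv_profile _ hσpos, Real.rpow_sub_one hσpos.ne', hρdef]
  have hdd2 : deriv (deriv fun s : ℝ ↦ (s + 1) ^ (1 / 2 : ℝ)) (P x) =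
      -(1 / 4) * (ρ / (P x + 1) ^ 2) := by
    rw [deriv_deriv_profile _ hσpos, Real.rpow_sub hσpos, Real.rpow_two, hρdef]
    ring
  have hdrift : lapAt G (fun y ↦ (P y + 1) ^ (1 / 2 : ℝ) + rmNormSqAt G y) x
        - fderiv ℝ (fun y ↦ (P y + 1) ^ (1 / 2 : ℝ) + rmNormSqAt G y) x W =
      1 / 2 * (ρ / (P x + 1)) * (lapAt G P x - fderiv ℝ P x W)
          + -(1 / 4) * (ρ / (P x + 1) ^ 2) * gradSqAt G P x
        + (lapAt G (rmNormSqAt G) x - fderiv ℝ (rmNormSqAt G) x W) := by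
    rw [hexp, hd1, hdd2]
  -- ### the real-variable lemmas
  have hA := mw_sqrt_cov_drift_ge hP0 hρ0 hρ2 (Real.sqrt_le_sqrt hMK) (Real.sqrt_nonneg K₀) hC₁ hQ0
    hCov hKato
  exact mw_cov_rm_drift_arith hρ2 hM0 hMK (Real.sqrt_nonneg _) (Real.sqrt_le_sqrt hMK) hC₅ hRm hA
    hdrift

end MetricCoord

end Literature.Geometry.Lorentzian

end
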